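import Literature.MathematicalPhysics.QuantumFieldTheory.Balaban1983to89.B6SectAOntoV1
import Summits.QuantumFields.YangMills.Theorems.UnitScaleTiltProp7FlatCurlCurl
import Summits.QuantumFields.YangMills.Theorems.UnitScaleTiltProp7TrueLinLineBound
import Mathlib.Algebra.Order.Chebyshev
import HarnessLib

/-!
# BalabanUVNodes ∕ N12 — (J-b) module H5: THE FIRST RUNG OF THE (46)-CLASS UPPER LETTER — «GRAM FLOOR ⇒ RIGHT INVERSE WITH A LETTER» (folklore linear algebra on finite kernels),
# and the ONE-LEVEL straight average on the torus: the minimal-norm right inverse `H` of `Q = bondAvg` with a VOLUME-UNIFORM bond-`ℓ²` letter `Σ_b (Hv)(b)² ≤ L^{d+2}·Σ_c v(c)²` (the far-face test field's cost)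

Cell `pub-ymgap` (HUMAN RULINGS D-0062 ∕ D-0149), width seat `pub-ymgap-dag-n10-w1` g4 (modules H4∕H4b of this lineage: `…N12FlatRightInverseLetterFloor[Weighted]`, p625544∕p626934 — the FLOOR).
`--kind proof --supports stmt-QuantumFields-27364 --as helper` (K1⁹, KEY MAP v2); count-neutral; THEOREMS ONLY (0 `def`, 0 `sorry`, 0 `instance`, 0 `notation`).  Item (i-c)₁ of this seat's
LOCATED-RHO-2 (INBOX 2026-08-28 l.≈36157), the one-level rung: dag-n12-c g18's exit (b) wants a right-inverse letter `ρ = O(1)` in print's η-units; H4∕H4b show that is a property of the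
MINIMAL-NORM (non-local) inverse and amounts to a Gram floor for the constraint map.  THIS FILE proves the abstract step once and for all (§1) and instantiates it at ONE straight averaging
step on the whole torus with the far-face lift as TEST field.  HONEST VALUE STATEMENT: a test-field Gram floor never beats the test inverse's own cost (the minimal-norm inverse is by definition
no worse than any right inverse), so §4's letter `L^{d+2}` is p11's `bondLift` cost crudely counted (exactly `L^{d+1}`); print's optimal one-level constant `3L^{d+2}∕(L²+2)` comes from the EXACT
Gram form `‖Qᵗg‖² ≥ (L²+2)∕(3L^{d+2})·‖g‖²` (kernel `(Qᵗg)(⟨B(W,ρ),μ⟩) = L^{−(d+1)}((ρ_μ+1)g⟨W,μ⟩ + (L−1−ρ_μ)g⟨W−e_μ,μ⟩)`, diagonal dominance, `Σ_{r<L}(2r+2−L)² = L(L²+2)∕3`) fed to §1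
— NOT typed here; the multi-level reading-(b) map with the comb gradient (the record's `Lf` at `Bj M₁ Z k`) is the open (46)-class item.  (UST `Prop7AvgLinearisation.exists_rightInverse_iterLin`
has the k-fold TOP-level true linearisation with SUP-constant one by the comb-free far-face device; this file's currency is bond-`ℓ²` and its §1 is the route to non-local optimal constants.)

CONSUMED BY NAME, nothing modified: lit-balaban p11's `B5AveragingOnto.bondLift`∕`bondAvg_bondLift` (the far-face right inverse of `Q`, used here only as a TEST FIELD), the V1 calculus
`LatticeFieldCalculus` (`bondAvg`), `TorusGeometry` (`blockOf_blockSite`), UST re-indexing (`Prop7FlatCurlCurl.sum_bond_eq_sum_site_dir`, `Prop7TrueLinLineBound.sum_site_eq_sum_blockSite`), `BIJ85AxialPropagator411.bondAvg_add∕_smul` (linearity),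
Mathlib (`Finset.sum_mul_sq_le_sq_mul_sq`, `LinearMap.injective_iff_surjective`, `LinearEquiv.ofBijective`).

CONTENTS (ns `Summit.QuantumFields.YangMills.BalabanUVNodes.N12FlatOneLevelGramRightInverse`).
§1 ★★ `exists_rightInverse_of_gram_floor` [folklore] — for a real kernel `q : β → α → ℝ` on finite types, a Gram floor `c₀·Σ_c g(c)² ≤ Σ_b (Σ_c q(c,b)g(c))²` (`c₀ > 0`) gives a LINEAR
right inverse `H` of `Y ↦ (Σ_b q(c,b)Y(b))_c` with `Σ_b (Hv)(b)² ≤ c₀⁻¹·Σ_c v(c)²` (the minimal-norm solution `H = qᵗ(qqᵗ)⁻¹`; injective ⇒ bijective in finite dimension; Cauchy–Schwarz).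
§2 `bondAvg_eq_sum_kernel` (`(QY)(c) = Σ_b Q(c,b)·Y(b)`), `sum_sq_block_pullback` (`Σ_b g(c_b)² = L^d·Σ_c g(c)²`), `sum_sq_bondLift_le`
(`Σ_b (bondLift g)(b)² ≤ L^{d+2}·Σ_c g(c)²`).  §3 ★★ `gram_floor_bondAvg` (`(L^{d+2})⁻¹·Σ_c g(c)² ≤ Σ_b (Qᵗg)(b)²`, by the far-face TEST field: `Σ_c g² = ⟨Q(bondLift g), g⟩ = ⟨bondLift g, Qᵗg⟩`).
§4 ★★★ `exists_rightInverse_bondAvg_sq_le` (`∃ H` linear, `Q(Hv) = v`, `Σ_b (Hv)(b)² ≤ L^{d+2}·Σ_c v(c)²`), ★★★ `exists_rightInverse_smul_bondAvg_sq_le` (for the scaled one-step `L•Q`, the straight part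
of `Q^{(1)}`: `Σ_b (H′v)(b)² ≤ L^d·Σ_c v(c)²` — in η-units at level one (weight `L^{d−2}`) the letter is `ρ² ≤ L²`, VOLUME-UNIFORM; print's optimal one-level constant is `3L^{d−2}(1 + 2L^{−2})^{−1}`,
— the test-field route stops at the far-face cost; the exact Gram symbol `L^{−d}(⅔ + ⅓cos θ)` of `QQᵗ` is not typed).

HONEST FRAMING.  Linear algebra + one-level lattice bookkeeping at the FLAT configuration; real-valued fields (matrix∕`𝔰𝔲(N)` fields follow entrywise, not typed here); ONE level, whole torus, no
comb term, no region; the multi-level ∕ reading-(b) ∕ comb Gram floor (= the `O(1)` letter of J-C's `ρc` in `qEta`-units) is OPEN and crux-sized ([Balaban1985Variational] (44)–(46) with [13]∕[14]);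
nothing of Bałaban's asserted beyond this one-level count; N12 ∕ N10 NOT discharged; K1⁹ NOT closed; count-neutral (typed 28∕28 · discharged 5∕27 unmoved); one finite 𝕋⁴ programme at fixed ε — R4 closes the
conditional finite-𝕋⁴ rung `BalabanLadder.UV` only; the YM mass gap (Clay) is NOT proved by any of this; nothing continuum ∕ ℝ⁴ ∕ OS.
-/

noncomputable section
open scoped BigOperators
open Finset
namespace Summit.QuantumFields.YangMills.BalabanUVNodes.N12FlatOneLevelGramRightInverse

open Literature.MathematicalPhysics.QuantumFieldTheory.Balaban1983to89
open LatticeFieldCalculus (bondAvg)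
open B5AveragingOnto (bondLift bondAvg_bondLift)
open Literature.MathematicalPhysics.QuantumFieldTheory.BalabanImbrieJaffe1984to88.BIJ85AxialPropagator411 (bondAvg_add bondAvg_smul)
open Summit.QuantumFields.YangMills.Theorems.Prop7FlatCurlCurl (sum_bond_eq_sum_site_dir)
open Summit.QuantumFields.YangMills.Theorems.Prop7TrueLinLineBound (sum_site_eq_sum_blockSite)

/-! ## §1  [folklore] Gram floor ⇒ right inverse with a letter -/

section Gram

/-- ★★ **GRAM FLOOR ⇒ BOUNDED LINEAR RIGHT INVERSE** [folklore].  For a real kernel `q : β → α → ℝ` on finite index types — the operator `(TY)(c) = Σ_b q(c,b)·Y(b)` and its transpose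
`(Tᵗg)(b) = Σ_c q(c,b)·g(c)` — a Gram floor `c₀·Σ_c g(c)² ≤ Σ_b (Tᵗg)(b)²` with `0 < c₀` yields a LINEAR right inverse `H` of `T` with `Σ_b (Hv)(b)² ≤ c₀⁻¹·Σ_c v(c)²`: `Tᵗ` is injective, so
`G = TTᵗ` is injective (`⟨Gg, g⟩ = ‖Tᵗg‖²`), hence bijective (finite dimension); `H := Tᵗ∘G⁻¹`; with `g = G⁻¹v`, `‖Hv‖² = ⟨v, g⟩ =: S`, `S ≥ c₀‖g‖²`, `S² ≤ ‖v‖²‖g‖²`, so `S ≤ ‖v‖²∕c₀`.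
This is the algebraic core of every (46)-type letter: the analysis is in the floor `c₀`. [cite: Balaban1985Variational, (44)-(46) p.285] -/
theorem exists_rightInverse_of_gram_floor {α β : Type*} [Fintype α] [Fintype β] (q : β → α → ℝ) {c₀ : ℝ} (hc₀ : 0 < c₀)
    (hgram : ∀ g : β → ℝ, c₀ * ∑ c, g c ^ 2 ≤ ∑ b, (∑ c, q c b * g c) ^ 2) :
    ∃ H : (β → ℝ) →ₗ[ℝ] (α → ℝ), (∀ v c, ∑ b, q c b * H v b = v c) ∧ ∀ v, ∑ b, (H v b) ^ 2 ≤ c₀⁻¹ * ∑ c, (v c) ^ 2 := by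
  classical
  let T : (α → ℝ) →ₗ[ℝ] (β → ℝ) :=
    { toFun := fun Y c => ∑ b, q c b * Y b
      map_add' := fun Y Y' => funext fun c => by simp only [Pi.add_apply, mul_add, Finset.sum_add_distrib]
      map_smul' := fun r Y => funext fun c => by simp only [Pi.smul_apply, smul_eq_mul, RingHom.id_apply, Finset.mul_sum, mul_left_comm] }
  let Tt : (β → ℝ) →ₗ[ℝ] (α → ℝ) :=
    { toFun := fun g b => ∑ c, q c b * g c
      map_add' := fun g g' => funext fun b => by simp only [Pi.add_apply, mul_add, Finset.sum_add_distrib]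
      map_smul' := fun r g => funext fun b => by simp only [Pi.smul_apply, smul_eq_mul, RingHom.id_apply, Finset.mul_sum, mul_left_comm] }
  have hT : ∀ Y c, T Y c = ∑ b, q c b * Y b := fun _ _ => rfl
  have hTt : ∀ g b, Tt g b = ∑ c, q c b * g c := fun _ _ => rfl
  have hadj : ∀ (Y : α → ℝ) (g : β → ℝ), ∑ c, T Y c * g c = ∑ b, Y b * Tt g b := by
    intro Y g
    simp only [hT, hTt, Finset.sum_mul, Finset.mul_sum]
    rw [Finset.sum_comm]
    exact Finset.sum_congr rfl fun b _ => Finset.sum_congr rfl fun c _ => by ring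
  let G : (β → ℝ) →ₗ[ℝ] (β → ℝ) := T ∘ₗ Tt
  have hG : ∀ g, G g = T (Tt g) := fun _ => rfl
  have hGg : ∀ g : β → ℝ, ∑ c, G g c * g c = ∑ b, Tt g b ^ 2 := by
    intro g
    rw [hG, hadj]
    exact Finset.sum_congr rfl fun b _ => by ring
  have hinj : Function.Injective G := by
    intro g g' h
    have h0 : G (g - g') = 0 := by rw [map_sub, h, sub_self]
    have h1 : ∑ b, Tt (g - g') b ^ 2 = 0 := by rw [← hGg, h0]; simp
    have h2 : c₀ * ∑ c, (g - g') c ^ 2 ≤ 0 := by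
      have := hgram (g - g')
      simp only [hTt] at h1
      rwa [h1] at this
    have h3 : ∑ c, (g - g') c ^ 2 ≤ 0 := by
      by_contra hlt
      have := mul_pos hc₀ (not_le.mp hlt)
      linarith
    funext c
    have hle : (g - g') c ^ 2 ≤ 0 := (Finset.single_le_sum (f := fun c => (g - g') c ^ 2) (fun c _ => sq_nonneg _) (Finset.mem_univ c)).trans h3
    have := pow_eq_zero_iff (n := 2) (by norm_num) |>.mp (le_antisymm hle (sq_nonneg _))
    rwa [Pi.sub_apply, sub_eq_zero] at this
  let Ge : (β → ℝ) ≃ₗ[ℝ] (β → ℝ) := LinearEquiv.ofBijective G ⟨hinj, LinearMap.injective_iff_surjective.mp hinj⟩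
  have hGe : ∀ g, Ge g = G g := fun _ => rfl
  refine ⟨Tt ∘ₗ (Ge.symm : (β → ℝ) →ₗ[ℝ] (β → ℝ)), fun v c => ?_, fun v => ?_⟩
  · have h1 : T (Tt (Ge.symm v)) = v := by rw [← hG, ← hGe, LinearEquiv.apply_symm_apply]
    have := congrFun h1 c
    rwa [hT] at this
  · set g : β → ℝ := Ge.symm v with hg
    have hv : G g = v := by rw [← hGe, hg, LinearEquiv.apply_symm_apply]
    show ∑ b, Tt g b ^ 2 ≤ c₀⁻¹ * ∑ c, v c ^ 2
    set S : ℝ := ∑ b, Tt g b ^ 2 with hS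
    have hS0 : 0 ≤ S := Finset.sum_nonneg fun b _ => sq_nonneg _
    have hSvg : S = ∑ c, v c * g c := by rw [hS, ← hGg, hv]
    have hSg : c₀ * ∑ c, g c ^ 2 ≤ S := by
      have := hgram g
      simp only [← hTt] at this
      exact this
    have hCS : S ^ 2 ≤ (∑ c, v c ^ 2) * ∑ c, g c ^ 2 := by rw [hSvg]; exact Finset.sum_mul_sq_le_sq_mul_sq _ _ _
    have hA0 : 0 ≤ ∑ c, v c ^ 2 := Finset.sum_nonneg fun c _ => sq_nonneg _
    have h1 : S ^ 2 ≤ (∑ c, v c ^ 2) * (S / c₀) := by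
      refine hCS.trans (mul_le_mul_of_nonneg_left ?_ hA0)
      rw [le_div_iff₀ hc₀, mul_comm]
      exact hSg
    by_cases hS' : S = 0
    · rw [hS']; positivity
    · have hSpos : 0 < S := lt_of_le_of_ne hS0 (Ne.symm hS')
      have h2 : S * S ≤ (c₀⁻¹ * ∑ c, v c ^ 2) * S := by
        calc S * S = S ^ 2 := (sq S).symm
          _ ≤ (∑ c, v c ^ 2) * (S / c₀) := h1
          _ = (c₀⁻¹ * ∑ c, v c ^ 2) * S := by rw [div_eq_mul_inv]; ring
      exact le_of_mul_le_mul_right h2 hSpos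

end Gram

/-! ## §2  One-level bookkeeping: the straight average as a kernel; the far-face lift's bond-`ℓ²` size -/

section OneLevel

variable {P : Params} {j : ℕ}

/-- **THE STRAIGHT AVERAGE THROUGH ITS KERNEL** (real fields): `(QY)(c) = Σ_b Q(c,b)·Y(b)`, `Q(c,b) = (Q e_b)(c)` (linearity of (1.11)). [cite: Balaban1984PropagatorsI, (1.11) p.19] -/
theorem bondAvg_eq_sum_kernel [DecidableEq (PBond P j)] (Y : VecField P j ℝ) (c : PBond P (j + 1)) :
    bondAvg Y c = ∑ b, bondAvg (Pi.single b (1 : ℝ)) c * Y b := by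
  have hY : Y = ∑ b, Y b • (Pi.single b (1 : ℝ) : VecField P j ℝ) := by
    funext b'
    rw [Finset.sum_apply, Finset.sum_eq_single b' (fun b _ hb => by rw [Pi.smul_apply, Pi.single_eq_of_ne' hb, smul_zero])
      (fun h => absurd (Finset.mem_univ _) h), Pi.smul_apply, Pi.single_eq_same, smul_eq_mul, mul_one]
  -- one-level linearity packaged (lit-balaban's `bondAvgIterLin` is pinned at the finest level)
  let QL : VecField P j ℝ →ₗ[ℝ] VecField P (j + 1) ℝ :=
    { toFun := bondAvg
      map_add' := bondAvg_add
      map_smul' := bondAvg_smul }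
  have hQL : ∀ Z : VecField P j ℝ, QL Z = bondAvg Z := fun _ => rfl
  have hlin : bondAvg (∑ b, Y b • (Pi.single b (1 : ℝ) : VecField P j ℝ)) = ∑ b, Y b • bondAvg (Pi.single b (1 : ℝ) : VecField P j ℝ) := by
    have h := map_sum QL (fun b => Y b • (Pi.single b (1 : ℝ) : VecField P j ℝ)) Finset.univ
    simp only [hQL] at h
    simp only [bondAvg_smul] at h
    exact h
  conv_lhs => rw [hY]
  rw [hlin, Finset.sum_apply]
  exact Finset.sum_congr rfl fun b _ => by rw [Pi.smul_apply, smul_eq_mul, mul_comm]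

/-- **Block pull-back count**: `Σ_b g(⟨B(b₋), dir b⟩)² = L^d·Σ_c g(c)²` — every coarse bond is the block-bond of exactly `L^d` fine bonds (standing range).
[cite: Balaban1984PropagatorsI, (1.11) p.19] -/
theorem sum_sq_block_pullback (hj : j + 1 ≤ P.m + P.K) (g : VecField P (j + 1) ℝ) :
    ∑ b : PBond P j, g ⟨blockOf b.src, b.dir⟩ ^ 2 = (P.L : ℝ) ^ P.d * ∑ c : PBond P (j + 1), g c ^ 2 := by
  rw [sum_bond_eq_sum_site_dir, sum_site_eq_sum_blockSite hj, sum_bond_eq_sum_site_dir, Finset.mul_sum]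
  refine Finset.sum_congr rfl fun y _ => ?_
  rw [Finset.mul_sum]
  have hin : ∀ r : Fin P.d → Fin P.L, ∑ μ : Fin P.d, g ⟨blockOf (Site.blockSite y r), μ⟩ ^ 2 = ∑ μ : Fin P.d, g ⟨y, μ⟩ ^ 2 := fun r => by
    simp only [Site.blockOf_blockSite hj]
  simp only [hin, Finset.sum_const, Finset.card_univ, Fintype.card_fun, Fintype.card_fin, nsmul_eq_mul]
  push_cast
  rw [Finset.mul_sum]

/-- **THE FAR-FACE LIFT's bond-`ℓ²` SIZE**: `Σ_b (bondLift g)(b)² ≤ L^{d+2}·Σ_c g(c)²` (`(bondLift g)(b) ∈ {0, L·g(c_b)}`, then the pull-back count; the exact value is `L^{d+1}·Σg²` — far faces have `L^{d−1}`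
bonds per block — the crude count costs one `L`). [cite: Balaban1984PropagatorsI, (1.11) p.19] -/
theorem sum_sq_bondLift_le (hj : j + 1 ≤ P.m + P.K) (g : VecField P (j + 1) ℝ) :
    ∑ b : PBond P j, bondLift g b ^ 2 ≤ (P.L : ℝ) ^ (P.d + 2) * ∑ c : PBond P (j + 1), g c ^ 2 := by
  have hpt : ∀ b : PBond P j, bondLift g b ^ 2 ≤ (P.L : ℝ) ^ 2 * g ⟨blockOf b.src, b.dir⟩ ^ 2 := by
    intro b
    unfold bondLift
    split_ifs
    · rw [mul_pow]
    · rw [zero_pow two_ne_zero]; positivity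
  calc ∑ b : PBond P j, bondLift g b ^ 2 ≤ ∑ b : PBond P j, (P.L : ℝ) ^ 2 * g ⟨blockOf b.src, b.dir⟩ ^ 2 := Finset.sum_le_sum fun b _ => hpt b
    _ = (P.L : ℝ) ^ 2 * ((P.L : ℝ) ^ P.d * ∑ c : PBond P (j + 1), g c ^ 2) := by rw [← Finset.mul_sum, sum_sq_block_pullback hj]
    _ = (P.L : ℝ) ^ (P.d + 2) * ∑ c : PBond P (j + 1), g c ^ 2 := by ring

/-! ## §3  The Gram floor of one straight averaging step -/

/-- ★★ **THE ONE-LEVEL GRAM FLOOR**: `(L^{d+2})⁻¹·Σ_c g(c)² ≤ Σ_b (Qᵗg)(b)²`, `(Qᵗg)(b) = Σ_c Q(c,b)·g(c)` — by the far-face TEST field `Y = bondLift g`: `Σ_c g(c)² = Σ_c (QY)(c)g(c)` (p11's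
`bondAvg_bondLift`) `= Σ_b Y(b)·(Qᵗg)(b) ≤ ‖Y‖·‖Qᵗg‖` and `‖Y‖² ≤ L^{d+2}·Σg²` (§2).  (A test-field floor equals the test inverse's own cost — here `bondLift`'s, crudely counted; print's exact floor `(L²+2)∕(3L^{d+2})` from the Gram symbol `L^{−d}(⅔ + ⅓cos θ)` is NOT typed.)
[cite: Balaban1984PropagatorsI, (1.11) p.19; Balaban1985Variational, (44)-(46) p.285] -/
theorem gram_floor_bondAvg [DecidableEq (PBond P j)] (hj : j + 1 ≤ P.m + P.K) (g : VecField P (j + 1) ℝ) :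
    ((P.L : ℝ) ^ (P.d + 2))⁻¹ * ∑ c, g c ^ 2 ≤ ∑ b, (∑ c, bondAvg (Pi.single b (1 : ℝ)) c * g c) ^ 2 := by
  have hL : (0 : ℝ) < (P.L : ℝ) := Nat.cast_pos.mpr P.L_pos
  have hM : (0 : ℝ) < (P.L : ℝ) ^ (P.d + 2) := by positivity
  set Y : VecField P j ℝ := bondLift g with hYdef
  set S : ℝ := ∑ c, g c ^ 2 with hS
  set R : ℝ := ∑ b, (∑ c, bondAvg (Pi.single b (1 : ℝ)) c * g c) ^ 2 with hR
  have hS0 : 0 ≤ S := Finset.sum_nonneg fun c _ => sq_nonneg _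
  have hR0 : 0 ≤ R := Finset.sum_nonneg fun b _ => sq_nonneg _
  -- `S = Σ_b Y(b)·(Qᵗg)(b)`
  have hSY : S = ∑ b, Y b * ∑ c, bondAvg (Pi.single b (1 : ℝ)) c * g c := by
    have h1 : S = ∑ c, bondAvg Y c * g c := by
      rw [hS, hYdef, bondAvg_bondLift hj]
      exact Finset.sum_congr rfl fun c _ => by ring
    have h2 : ∀ c, bondAvg Y c = ∑ b, bondAvg (Pi.single b (1 : ℝ)) c * Y b := fun c => bondAvg_eq_sum_kernel Y c
    rw [h1]
    simp only [h2, Finset.sum_mul, Finset.mul_sum]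
    rw [Finset.sum_comm]
    exact Finset.sum_congr rfl fun b _ => Finset.sum_congr rfl fun c _ => by ring
  -- Cauchy–Schwarz and the size of the test field
  have hCS : S ^ 2 ≤ (∑ b, Y b ^ 2) * R := by rw [hSY]; exact Finset.sum_mul_sq_le_sq_mul_sq _ _ _
  have hYle : ∑ b, Y b ^ 2 ≤ (P.L : ℝ) ^ (P.d + 2) * S := sum_sq_bondLift_le hj g
  have h1 : S ^ 2 ≤ ((P.L : ℝ) ^ (P.d + 2) * S) * R := hCS.trans (mul_le_mul_of_nonneg_right hYle hR0)
  by_cases hS' : S = 0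
  · rw [hS', mul_zero]; exact hR0
  · have hSpos : 0 < S := lt_of_le_of_ne hS0 (Ne.symm hS')
    have h2 : (((P.L : ℝ) ^ (P.d + 2))⁻¹ * S) * S ≤ R * S := by
      have h3 : S * S ≤ ((P.L : ℝ) ^ (P.d + 2) * R) * S := by
        calc S * S = S ^ 2 := (sq S).symm
          _ ≤ ((P.L : ℝ) ^ (P.d + 2) * S) * R := h1
          _ = ((P.L : ℝ) ^ (P.d + 2) * R) * S := by ring
      have h4 : S ≤ (P.L : ℝ) ^ (P.d + 2) * R := le_of_mul_le_mul_right h3 hSpos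
      calc (((P.L : ℝ) ^ (P.d + 2))⁻¹ * S) * S ≤ (((P.L : ℝ) ^ (P.d + 2))⁻¹ * ((P.L : ℝ) ^ (P.d + 2) * R)) * S :=
            mul_le_mul_of_nonneg_right (mul_le_mul_of_nonneg_left h4 (by positivity)) hS0
        _ = R * S := by rw [← mul_assoc, inv_mul_cancel₀ hM.ne', one_mul]
    exact le_of_mul_le_mul_right h2 hSpos

/-! ## §4  The one-level right inverse with its volume-uniform letter -/

/-- ★★★ **A LINEAR RIGHT INVERSE OF THE ONE-STEP STRAIGHT AVERAGE WITH A VOLUME-UNIFORM bond-`ℓ²` LETTER**: `∃ H`, `Q(Hv) = v` and `Σ_b (Hv)(b)² ≤ L^{d+2}·Σ_c v(c)²` for every coarse field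
`v` (§1 with the floor of §3; `H` is the minimal-norm solution — its letter here is the far-face test field's cost, NOT print's optimal `3L^{d+2}∕(L²+2)`, which needs the exact Gram form).
[cite: Balaban1985Variational, (44)-(46) p.285; Balaban1984PropagatorsI, (1.11) p.19] -/
theorem exists_rightInverse_bondAvg_sq_le (hj : j + 1 ≤ P.m + P.K) :
    ∃ H : VecField P (j + 1) ℝ →ₗ[ℝ] VecField P j ℝ, (∀ v, bondAvg (H v) = v) ∧ ∀ v, ∑ b, (H v b) ^ 2 ≤ (P.L : ℝ) ^ (P.d + 2) * ∑ c, (v c) ^ 2 := by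
  classical
  have hL : (0 : ℝ) < (P.L : ℝ) := Nat.cast_pos.mpr P.L_pos
  have hc₀ : (0 : ℝ) < ((P.L : ℝ) ^ (P.d + 2))⁻¹ := by positivity
  obtain ⟨H, hH, hHle⟩ := exists_rightInverse_of_gram_floor (fun (c : PBond P (j + 1)) (b : PBond P j) => bondAvg (Pi.single b (1 : ℝ)) c) hc₀
    (fun g => gram_floor_bondAvg hj g)
  refine ⟨H, fun v => funext fun c => ?_, fun v => ?_⟩
  · rw [bondAvg_eq_sum_kernel]; exact hH v c
  · have := hHle v; rwa [inv_inv] at this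

/-- ★★★ **THE SAME FOR THE SCALED ONE-STEP `L•Q`** (the straight part of the true linearisation `Q^{(1)} = L·Q₁ − dΛ₁`, [Balaban1985Averaging] (124)–(125)): `∃ H′` linear with `L•Q(H′v) = v` and
`Σ_b (H′v)(b)² ≤ L^d·Σ_c v(c)²` — in print's η-units at level one (weight `L^{d−2}`, module H4b ∕ the Defs file's `levelWeight 1`) the letter is `ρ² ≤ L²`, uniform in the volume.
[cite: Balaban1985Variational, (44)-(46) p.285; Balaban1985Averaging, (124)-(125) p.36] -/
theorem exists_rightInverse_smul_bondAvg_sq_le (hj : j + 1 ≤ P.m + P.K) :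
    ∃ H' : VecField P (j + 1) ℝ →ₗ[ℝ] VecField P j ℝ, (∀ v, (P.L : ℝ) • bondAvg (H' v) = v) ∧ ∀ v, ∑ b, (H' v b) ^ 2 ≤ (P.L : ℝ) ^ P.d * ∑ c, (v c) ^ 2 := by
  have hL : (P.L : ℝ) ≠ 0 := Nat.cast_ne_zero.mpr P.L_pos.ne'
  obtain ⟨H, hH, hHle⟩ := exists_rightInverse_bondAvg_sq_le (P := P) hj
  refine ⟨(P.L : ℝ)⁻¹ • H, fun v => ?_, fun v => ?_⟩
  · rw [LinearMap.smul_apply, Literature.MathematicalPhysics.QuantumFieldTheory.BalabanImbrieJaffe1984to88.BIJ85AxialPropagator411.bondAvg_smul, hH, smul_smul,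
      mul_inv_cancel₀ hL, one_smul]
  · have h1 : ∀ b, (((P.L : ℝ)⁻¹ • H) v b) ^ 2 = ((P.L : ℝ) ^ 2)⁻¹ * (H v b) ^ 2 := fun b => by
      rw [LinearMap.smul_apply, Pi.smul_apply, smul_eq_mul, mul_pow, inv_pow]
    simp only [h1, ← Finset.mul_sum]
    calc ((P.L : ℝ) ^ 2)⁻¹ * ∑ b, H v b ^ 2 ≤ ((P.L : ℝ) ^ 2)⁻¹ * ((P.L : ℝ) ^ (P.d + 2) * ∑ c, v c ^ 2) :=
          mul_le_mul_of_nonneg_left (hHle v) (by positivity)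
      _ = (P.L : ℝ) ^ P.d * ∑ c, v c ^ 2 := by rw [← mul_assoc, pow_add, mul_comm ((P.L : ℝ) ^ P.d), ← mul_assoc, inv_mul_cancel₀ (pow_ne_zero 2 hL), one_mul]

end OneLevel

end Summit.QuantumFields.YangMills.BalabanUVNodes.N12FlatOneLevelGramRightInverse
end
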